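import Literature.Combinatorics.Optimization.MatchingJunta
import Literature.Combinatorics.Optimization.EquivariantPsdFactorization
import Literature.RepresentationTheory.FiniteGroups.FourierVanishingSmallDim
import Literature.RepresentationTheory.FiniteGroups.FourierVanishingPairStabilizer
import Literature.RepresentationTheory.FiniteGroups.SymmetricGroupCosetSpanProofs
import Literature.NumberTheory.DiophantineGeometry.StandardTableauxDichotomy
import Literature.Barriers.PneNP.TSPExtensionComplexityRothvossCounts
import HarnessLib

/-!
# Low-dimensional `𝔖ₙ`-invariant spaces of functions on perfect matchings have low degree

The matching analogue of the Fawzi–Saunderson–Parrilo argument for the parity polytope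
(*Equivariant semidefinite lifts and sum-of-squares hierarchies*, arXiv:1312.6662, §5: a
low-dimensional invariant subspace of functions on the vertices consists of low-degree functions),
assembled from printed ingredients: the Fourier transform on `𝔖ₙ` intertwines left translation
(Ellis–Friedgut–Pilpel 2011, §2.2) so a left-invariant space of dimension `< f^μ` has no `[μ]`
component (`FourierVanishingSmallDim.lean`); right invariance under the pair-swaps of a perfect
matching kills every `[μ]` with more than `n/2` rows (transposition trick, Fulton–Harris Lemma
4.23; `FourierVanishingPairStabilizer.lean`); the dimension dichotomy `f^μ ≥ 2^{⌊t/2⌋}` unless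
`μ₁ > n - t` or `μ'₁ > n - t` (`StandardTableauxDichotomy.lean`); Ellis–Friedgut–Pilpel's Theorem 7
(`V_{2k}` = span of `2k`-coset indicators, `SymmetricGroupCosetSpanProofs.lean`); and the junta
lemma for the perfect matching scheme (Godsil–Meagher Ch. 15; `MatchingJunta.lean`).

Result `invariantSubspaceLowDegree` (the cell pnp-psdrank's typed `InvariantSubspaceLowDegree`,
HOME/pnp-psdrank-p2/Sketch-v3.lean §4, crux 2 of the rung route `EquivariantThetaLift`,
verbatim): for even `n ≥ 4k + 2`, every `𝔖ₙ`-invariant subspace `V` of real functions on the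
perfect matchings of `K_n` with `dim V < 2^k` is contained in `Pol_{≤k}`.

Proof. Fix a perfect matching `M₀`; pull `g ∈ V` back to `𝔖ₙ`, `F_g(σ) = g(σ·M₀)`. The complex
span `W` of the `F_g` is left-invariant of dimension `≤ dim V < 2^k` and consists of functions
right-invariant under the pair-swaps of `M₀`. For `μ₁ < n - 2k`: if also `μ'₁ ≤ n - 2k` then
`f^μ ≥ 2^k > dim W` and `F̂(μ) = 0` on `W`; otherwise `μ'₁ > n - 2k ≥ n/2 = |M₀|` and again
`F̂(μ) = 0`. Hence `W ⊆ V_{2k} =` span of `2k`-coset indicators `1_{T(a,b)}`. Pushing forward along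
`σ ↦ σ·M₀` (summing over the fibre) sends `F_g` to `|Stab M₀|·g` and `1_{T(a,b)}` to the pin count
`M ↦ #{σ : σ·M₀ = M, σ∘a = b}`, which is invariant under the pointwise stabiliser of the `≤ 2k`
points `b(i)` and therefore lies in `Pol_{≤k}` by the junta lemma.

## References

* H. Fawzi, J. Saunderson, P. A. Parrilo, arXiv:1312.6662, §5 (invariant subspaces of functions on
  the vertices; the parity polytope case). [FawziSaundersonParrilo2013]
* D. Ellis, E. Friedgut, H. Pilpel, J. AMS 24 (2011), §2.2 and Thm. 7. [EllisFriedgutPilpel2011]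
* C. Godsil, K. Meagher, *Erdős–Ko–Rado Theorems: Algebraic Approaches*, CUP 2016, Ch. 15. [GodsilMeagher2015]
-/

noncomputable section

open Finset
open scoped BigOperators
open Literature.Barriers.PneNP (IsPMOn exists_isPMOn_of_even IsPMOn.two_mul_card)
open Literature.RepresentationTheory.FiniteGroups Literature.NumberTheory.DiophantineGeometry

namespace Literature.Combinatorics.Optimization

namespace MatchingInvariantSubspaces

variable {n : ℕ}

/-! ### The number of first-column entries of the canonical tableau -/

/-- The first column of the canonical tableau has `μ'₁` entries. [cite: GodsilMeagher2015, §12 (tableaux)] -/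
theorem sup_parts_transpose_le_card_filter_colOf (μ : Nat.Partition n) :
    μ.transpose.parts.sup ≤ (univ.filter fun j : Fin n => μ.colOf j = 0).card := by
  classical
  rw [sup_parts_transpose_eq_colLen_zero, YoungDiagram.colLen_eq_card]
  rcases Nat.eq_zero_or_pos n with rfl | hn
  · -- no cells at all
    have h0 : (μ.youngDiagram.col 0).card = 0 := by
      rw [Finset.card_eq_zero, ← Finset.subset_empty]
      intro c hc
      have hcells : c ∈ μ.youngDiagram.cells := (YoungDiagram.mem_col_iff.1 hc).1
      have := μ.card_cells_youngDiagram
      rw [Finset.card_eq_zero] at this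
      rw [this] at hcells
      exact hcells
    rw [h0]; exact Nat.zero_le _
  haveI : Nonempty (Fin n) := ⟨⟨0, hn⟩⟩
  have hex : ∀ c ∈ μ.youngDiagram.col 0, ∃ i : Fin n, (μ.rowOf i, μ.colOf i) = c := fun c hc =>
    ((μ.mem_youngDiagram_iff_existsUnique_rowOf_colOf c).1 (YoungDiagram.mem_col_iff.1 hc).1).exists
  choose! ι hι using hex
  refine Finset.card_le_card_of_injOn ι (fun c hc => ?_) (fun c hc c' hc' h => ?_)
  · rw [Finset.mem_coe, Finset.mem_filter]
    refine ⟨mem_univ _, ?_⟩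
    have h := congrArg Prod.snd (hι c hc)
    rw [(YoungDiagram.mem_col_iff.1 hc).2] at h
    exact h
  · rw [← hι c hc, ← hι c' hc', h]

/-! ### Pulling functions on perfect matchings back to `𝔖ₙ` -/

variable (M₀ : PMSol n)

/-- `F_g(σ) = g(σ · M₀)` (complex-valued). [cite: FawziSaundersonParrilo2013, §5] -/
def pull (g : PMSol n → ℝ) : Equiv.Perm (Fin n) → ℂ := fun σ => ((g (σ • M₀) : ℝ) : ℂ)

/-- `pull` is additive. [cite: FawziSaundersonParrilo2013, §5] -/
theorem pull_add (g h : PMSol n → ℝ) : pull M₀ (g + h) = pull M₀ g + pull M₀ h := by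
  funext σ; simp [pull]

/-- `pull` is `ℝ`-homogeneous. [cite: FawziSaundersonParrilo2013, §5] -/
theorem pull_smul (c : ℝ) (g : PMSol n → ℝ) : pull M₀ (c • g) = (c : ℂ) • pull M₀ g := by
  funext σ; simp [pull]

/-- Left translation of a pull-back is the pull-back of the translated function.
[cite: EllisFriedgutPilpel2011, §2.2 (p. 6)] -/
theorem leftTranslate_pull (τ : Equiv.Perm (Fin n)) (g : PMSol n → ℝ) :
    leftTranslate τ (pull M₀ g) = pull M₀ (fun M => g (τ⁻¹ • M)) := by
  funext σ
  simp only [leftTranslate, pull, mul_smul]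

/-- A pair-swap of `M₀` fixes `M₀`. [cite: GodsilMeagher2015, §15.2] -/
theorem swap_smul_eq_self {p q : Fin n} (h : s(p, q) ∈ M₀.1) : Equiv.swap p q • M₀ = M₀ := by
  have hq : q = M₀.partner p := PMSol.mk_mem_iff.1 h
  apply Subtype.ext
  rw [PMSol.smul_val]
  have key : ∀ e ∈ M₀.1, Sym2.map (Equiv.swap p q) e = e := by
    intro e he
    by_cases hpe : p ∈ e
    · have : e = s(p, q) := by rw [PMSol.eq_edgeAt he hpe, PMSol.edgeAt_eq, ← hq]
      rw [this, Sym2.map_mk, Equiv.swap_apply_left, Equiv.swap_apply_right, Sym2.eq_swap]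
    · have hqe : q ∉ e := by
        intro hqe
        have : e = s(q, p) := by
          rw [PMSol.eq_edgeAt he hqe, PMSol.edgeAt_eq, hq, PMSol.partner_partner]
        exact hpe (this ▸ Sym2.mem_mk_right q p)
      induction e using Sym2.ind with
      | _ x y =>
        rw [Sym2.map_mk, Equiv.swap_apply_of_ne_of_ne, Equiv.swap_apply_of_ne_of_ne]
        · exact fun h => hpe (h ▸ Sym2.mem_mk_right x y)
        · exact fun h => hqe (h ▸ Sym2.mem_mk_right x y)
        · exact fun h => hpe (h ▸ Sym2.mem_mk_left x y)
        · exact fun h => hqe (h ▸ Sym2.mem_mk_left x y)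
  rw [image_congr (fun e he => key e he : Set.EqOn _ (fun e => e) _), image_id']

/-- Pull-backs are right-invariant under the pair-swaps of `M₀`. [cite: GodsilMeagher2015, §15.2] -/
theorem pull_mul_swap {p q : Fin n} (h : s(p, q) ∈ M₀.1) (g : PMSol n → ℝ) (σ : Equiv.Perm (Fin n)) :
    pull M₀ g (σ * Equiv.swap p q) = pull M₀ g σ := by
  simp only [pull, mul_smul, swap_smul_eq_self M₀ h]

/-! ### The complexified pull-back space and its Fourier support -/

variable (V : Submodule ℝ (PMSol n → ℝ))

/-- The complex span `W` of the pull-backs of (a basis of) `V`. [cite: FawziSaundersonParrilo2013, §5] -/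
def pullSpan : Submodule ℂ (Equiv.Perm (Fin n) → ℂ) :=
  Submodule.span ℂ (Set.range fun i : Fin (Module.finrank ℝ V) => pull M₀ (Module.finBasis ℝ V i))

/-- `dim_ℂ W ≤ dim_ℝ V`. [cite: FawziSaundersonParrilo2013, §5] -/
theorem finrank_pullSpan_le : Module.finrank ℂ (pullSpan M₀ V) ≤ Module.finrank ℝ V := by
  refine (finrank_range_le_card _).trans ?_
  rw [Fintype.card_fin]

/-- Every pull-back of an element of `V` lies in `W`. [cite: FawziSaundersonParrilo2013, §5] -/
theorem pull_mem_pullSpan {g : PMSol n → ℝ} (hg : g ∈ V) : pull M₀ g ∈ pullSpan M₀ V := by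
  set b := Module.finBasis ℝ V with hb
  have hrepr : g = ∑ i, (b.repr ⟨g, hg⟩ i) • (b i : PMSol n → ℝ) := by
    have h := b.sum_repr ⟨g, hg⟩
    have h' := congrArg (Subtype.val : V → PMSol n → ℝ) h
    rw [Submodule.coe_sum] at h'
    simp only [Submodule.coe_smul] at h'
    exact h'.symm
  rw [hrepr]
  have : pull M₀ (∑ i, (b.repr ⟨g, hg⟩ i) • (b i : PMSol n → ℝ)) =
      ∑ i, ((b.repr ⟨g, hg⟩ i : ℝ) : ℂ) • pull M₀ (b i) := by
    induction (Finset.univ : Finset (Fin (Module.finrank ℝ V))) using Finset.induction_on with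
    | empty => funext σ; simp [pull]
    | insert j s hj ih => rw [sum_insert hj, sum_insert hj, pull_add, pull_smul, ih]
  rw [this]
  exact Submodule.sum_mem _ fun i _ => Submodule.smul_mem _ _ (Submodule.subset_span ⟨i, rfl⟩)

variable {V}

/-- `W` is left-invariant when `V` is `𝔖ₙ`-invariant. [cite: EllisFriedgutPilpel2011, §2.2 (p. 6)] -/
theorem isLeftInvariant_pullSpan (hV : IsPermInvariant V) : IsLeftInvariant (pullSpan M₀ V) := by
  intro τ F hF
  induction hF using Submodule.span_induction with
  | mem F hF =>
    obtain ⟨i, rfl⟩ := hF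
    rw [leftTranslate_pull]
    exact pull_mem_pullSpan M₀ V (hV τ _ (Module.finBasis ℝ V i).2)
  | zero => exact Submodule.zero_mem _
  | add F G _ _ hF hG =>
    have : leftTranslate τ (F + G) = leftTranslate τ F + leftTranslate τ G := rfl
    rw [this]; exact Submodule.add_mem _ hF hG
  | smul c F _ hF =>
    have : leftTranslate τ (c • F) = c • leftTranslate τ F := rfl
    rw [this]; exact Submodule.smul_mem _ _ hF

/-- Elements of `W` are right-invariant under the pair-swaps of `M₀`. [cite: GodsilMeagher2015, §15.2] -/
theorem pullSpan_mul_swap {F : Equiv.Perm (Fin n) → ℂ} (hF : F ∈ pullSpan M₀ V) {p q : Fin n}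
    (h : s(p, q) ∈ M₀.1) (σ : Equiv.Perm (Fin n)) : F (σ * Equiv.swap p q) = F σ := by
  induction hF using Submodule.span_induction generalizing σ with
  | mem F hF => obtain ⟨i, rfl⟩ := hF; exact pull_mul_swap M₀ h _ σ
  | zero => rfl
  | add F G _ _ hF hG => simp only [Pi.add_apply, hF, hG]
  | smul c F _ hF => simp only [Pi.smul_apply, hF]

/-- **Fourier support**: for `4k + 2 ≤ n`, `V` invariant with `dim V < 2^k`, every
`F ∈ W` has `F̂([μ]) = 0` whenever `μ₁ < n - 2k`; i.e. `W ⊆ V_{2k}`.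
[cite: FawziSaundersonParrilo2013, §5] [cite: EllisFriedgutPilpel2011, Def. 12 (V_k)] -/
theorem pullSpan_le_efpV {k : ℕ} (hk : 4 * k + 2 ≤ n) (hV : IsPermInvariant V)
    (hdim : Module.finrank ℝ V < 2 ^ k) : pullSpan M₀ V ≤ efpV n (2 * k) := by
  intro F hF
  rw [mem_efpV_iff]
  intro μ hμ
  by_cases hcol : μ.transpose.parts.sup + 2 * k ≤ n
  · -- large irreducible: `f^μ ≥ 2^k > dim W`
    have hrow : μ.parts.sup + 2 * k ≤ n := by omega
    have hdich := spechtDimDichotomy n (2 * k) μ hrow hcol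
    rw [Nat.mul_div_cancel_left k two_pos] at hdich
    exact fourierSpecht_eq_zero_of_finrank_lt _ (isLeftInvariant_pullSpan M₀ hV) μ
      (lt_of_lt_of_le (lt_of_le_of_lt (finrank_pullSpan_le M₀ V) hdim) hdich) F hF
  · -- long first column: more than `n/2 = |M₀|` rows
    have hcard : 2 * M₀.1.card = n := by
      have := IsPMOn.two_mul_card M₀.2; rwa [card_univ, Fintype.card_fin] at this
    refine fourierSpecht_eq_zero_of_pairInvariant M₀.1 M₀.2 F
      (fun p q hpq σ => pullSpan_mul_swap M₀ hF hpq σ) μ ?_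
    refine lt_of_lt_of_le ?_ (sup_parts_transpose_le_card_filter_colOf μ)
    omega

/-! ### Pushing forward along the orbit map -/

/-- `push F (M) = Σ_{σ : σ·M₀ = M} F(σ)`. [cite: FawziSaundersonParrilo2013, §5] -/
def push (F : Equiv.Perm (Fin n) → ℂ) : PMSol n → ℂ :=
  fun M => ∑ σ ∈ univ.filter (fun σ : Equiv.Perm (Fin n) => σ • M₀ = M), F σ

/-- The fibres of the orbit map all have the size of the stabiliser.
[cite: GodsilMeagher2015, §15.2 (S_{2m} acts transitively on perfect matchings)] -/
theorem card_fibre (M : PMSol n) :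
    (univ.filter fun σ : Equiv.Perm (Fin n) => σ • M₀ = M).card =
      (univ.filter fun σ : Equiv.Perm (Fin n) => σ • M₀ = M₀).card := by
  classical
  -- transitivity: `M = π · M₀`
  obtain ⟨π, -, hπ⟩ := exists_perm_fix_smul_eq (∅ : Finset (Fin n)) M M₀ (by
    have : innerEdges (n := n) ∅ = ∅ := by
      ext e
      simp only [mem_innerEdges, Finset.notMem_empty, iff_false, not_forall]
      induction e using Sym2.ind with
      | _ x y => exact ⟨x, Sym2.mem_mk_left x y, not_false⟩
    rw [this, inter_empty, inter_empty])
  refine Finset.card_bij (fun σ _ => π⁻¹ * σ) (fun σ hσ => ?_) (fun σ _ σ' _ h => ?_) (fun σ hσ => ?_)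
  · rw [mem_filter] at hσ ⊢
    refine ⟨mem_univ _, ?_⟩
    rw [mul_smul, hσ.2, ← hπ, ← mul_smul, inv_mul_cancel, one_smul]
  · exact mul_left_cancel h
  · refine ⟨π * σ, ?_, by rw [← mul_assoc, inv_mul_cancel, one_mul]⟩
    rw [mem_filter] at hσ ⊢
    exact ⟨mem_univ _, by rw [mul_smul, hσ.2, hπ]⟩

/-- The stabiliser is non-empty. [cite: GodsilMeagher2015, §15.2] -/
theorem card_stab_pos : 0 < (univ.filter fun σ : Equiv.Perm (Fin n) => σ • M₀ = M₀).card :=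
  card_pos.2 ⟨1, mem_filter.2 ⟨mem_univ _, one_smul _ _⟩⟩

/-- **`push (pull g) = |Stab M₀| · g`.** [cite: FawziSaundersonParrilo2013, §5] -/
theorem push_pull (g : PMSol n → ℝ) (M : PMSol n) :
    push M₀ (pull M₀ g) M =
      ((univ.filter fun σ : Equiv.Perm (Fin n) => σ • M₀ = M₀).card : ℂ) * (g M : ℂ) := by
  rw [push, ← card_fibre M₀ M]
  have : ∀ σ ∈ univ.filter (fun σ : Equiv.Perm (Fin n) => σ • M₀ = M), pull M₀ g σ = (g M : ℂ) :=
    fun σ hσ => by rw [pull, (mem_filter.1 hσ).2]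
  rw [sum_congr rfl this, sum_const, nsmul_eq_mul]

/-- The pin count `M ↦ #{σ : σ·M₀ = M, σ(a i) = b i}` (real-valued).
[cite: EllisFriedgutPilpel2011, §1 (k-cosets T_{a ↦ b})] -/
def pinCount {t : ℕ} (a b : Fin t ↪ Fin n) : PMSol n → ℝ :=
  fun M => ((univ.filter fun σ : Equiv.Perm (Fin n) => σ • M₀ = M ∧ ∀ i, σ (a i) = b i).card : ℝ)

/-- **`push 1_{T(a,b)} = pinCount a b`.** [cite: EllisFriedgutPilpel2011, §1 (k-cosets)] -/
theorem push_indicator {t : ℕ} (a b : Fin t ↪ Fin n) (M : PMSol n) :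
    push M₀ ((kCoset a b).indicator 1) M = (pinCount M₀ a b M : ℂ) := by
  classical
  rw [push, pinCount, Complex.ofReal_natCast]
  rw [← Finset.sum_filter_add_sum_filter_not _ (fun σ => σ ∈ kCoset a b)]
  have h1 : ∀ σ ∈ (univ.filter fun σ : Equiv.Perm (Fin n) => σ • M₀ = M).filter (fun σ => σ ∈ kCoset a b),
      (kCoset a b).indicator (1 : Equiv.Perm (Fin n) → ℂ) σ = 1 := fun σ hσ =>
    Set.indicator_of_mem (mem_filter.1 hσ).2 _
  have h2 : ∀ σ ∈ (univ.filter fun σ : Equiv.Perm (Fin n) => σ • M₀ = M).filter (fun σ => σ ∉ kCoset a b),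
      (kCoset a b).indicator (1 : Equiv.Perm (Fin n) → ℂ) σ = 0 := fun σ hσ =>
    Set.indicator_of_notMem (mem_filter.1 hσ).2 _
  rw [sum_congr rfl h1, sum_congr rfl h2, sum_const_zero, add_zero, sum_const, nsmul_eq_mul, mul_one,
    filter_filter]
  congr 2
  refine filter_congr fun σ _ => ?_
  rw [mem_kCoset_iff]

/-- **Pin counts are invariant under the pointwise stabiliser of the target points.**
[cite: EllisFriedgutPilpel2011, §1 (k-cosets)] -/
theorem pinCount_smul {t : ℕ} (a b : Fin t ↪ Fin n) (π : Equiv.Perm (Fin n))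
    (hπ : ∀ x ∈ univ.image b, π x = x) (M : PMSol n) : pinCount M₀ a b (π • M) = pinCount M₀ a b M := by
  classical
  rw [pinCount, pinCount]
  congr 1
  refine Finset.card_bij (fun σ _ => π⁻¹ * σ) (fun σ hσ => ?_) (fun σ _ σ' _ h => ?_) (fun σ hσ => ?_)
  · rw [mem_filter] at hσ ⊢
    refine ⟨mem_univ _, ?_, fun i => ?_⟩
    · rw [mul_smul, hσ.2.1, ← mul_smul, inv_mul_cancel, one_smul]
    · rw [Equiv.Perm.mul_apply, hσ.2.2 i, Equiv.Perm.inv_eq_iff_eq]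
      exact (hπ (b i) (mem_image_of_mem b (mem_univ i))).symm
  · exact mul_left_cancel h
  · refine ⟨π * σ, ?_, by rw [← mul_assoc, inv_mul_cancel, one_mul]⟩
    rw [mem_filter] at hσ ⊢
    refine ⟨mem_univ _, by rw [mul_smul, hσ.2.1], fun i => ?_⟩
    rw [Equiv.Perm.mul_apply, hσ.2.2 i]
    exact hπ (b i) (mem_image_of_mem b (mem_univ i))

/-- **Pin counts of `t ≤ 2k` points have degree `≤ k`.** [cite: GodsilMeagher2015, §15.5] -/
theorem pinCount_mem_polLE {t k : ℕ} (ht : t ≤ 2 * k) (a b : Fin t ↪ Fin n) :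
    pinCount M₀ a b ∈ polLE n k := by
  classical
  refine mem_polLE_of_invariant (univ.image b) ?_ _ fun π hπ M => pinCount_smul M₀ a b π hπ M
  exact card_image_le.trans (by rw [card_univ, Fintype.card_fin]; exact ht)

/-! ### Real and imaginary parts of push-forwards of `V_{2k}` have low degree -/

/-- Real part of the normalised push-forward. [cite: FawziSaundersonParrilo2013, §5] -/
def pushRe (F : Equiv.Perm (Fin n) → ℂ) : PMSol n → ℝ := fun M => (push M₀ F M).re

/-- Imaginary part of the push-forward. [cite: FawziSaundersonParrilo2013, §5] -/
def pushIm (F : Equiv.Perm (Fin n) → ℂ) : PMSol n → ℝ := fun M => (push M₀ F M).im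

/-- Push-forwards of `2k`-coset combinations have real and imaginary parts in `Pol_{≤k}`.
[cite: EllisFriedgutPilpel2011, Thm. 7] [cite: GodsilMeagher2015, §15.5] -/
theorem pushRe_pushIm_mem_polLE {k : ℕ} {F : Equiv.Perm (Fin n) → ℂ} (hF : F ∈ kCosetSpan n (2 * k)) :
    pushRe M₀ F ∈ polLE n k ∧ pushIm M₀ F ∈ polLE n k := by
  classical
  induction hF using Submodule.span_induction with
  | mem F hF =>
    obtain ⟨a, b, rfl⟩ := hF
    have hre : pushRe M₀ ((kCoset a b).indicator 1) = pinCount M₀ a b := by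
      funext M; rw [pushRe, push_indicator, Complex.ofReal_re]
    have him : pushIm M₀ ((kCoset a b).indicator 1) = 0 := by
      funext M; rw [pushIm, push_indicator, Complex.ofReal_im]; rfl
    rw [hre, him]
    exact ⟨pinCount_mem_polLE M₀ le_rfl a b, Submodule.zero_mem _⟩
  | zero =>
    have h1 : pushRe M₀ (0 : Equiv.Perm (Fin n) → ℂ) = 0 := by
      funext M; simp [pushRe, push]
    have h2 : pushIm M₀ (0 : Equiv.Perm (Fin n) → ℂ) = 0 := by
      funext M; simp [pushIm, push]
    rw [h1, h2]; exact ⟨Submodule.zero_mem _, Submodule.zero_mem _⟩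
  | add F G _ _ hF hG =>
    have h1 : pushRe M₀ (F + G) = pushRe M₀ F + pushRe M₀ G := by
      funext M; simp [pushRe, push, sum_add_distrib]
    have h2 : pushIm M₀ (F + G) = pushIm M₀ F + pushIm M₀ G := by
      funext M; simp [pushIm, push, sum_add_distrib]
    rw [h1, h2]
    exact ⟨Submodule.add_mem _ hF.1 hG.1, Submodule.add_mem _ hF.2 hG.2⟩
  | smul c F _ hF =>
    have h1 : pushRe M₀ (c • F) = c.re • pushRe M₀ F - c.im • pushIm M₀ F := by
      funext M
      simp only [pushRe, pushIm, push, Pi.smul_apply, Pi.sub_apply, smul_eq_mul, ← mul_sum, Complex.mul_re]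
    have h2 : pushIm M₀ (c • F) = c.re • pushIm M₀ F + c.im • pushRe M₀ F := by
      funext M
      simp only [pushRe, pushIm, push, Pi.smul_apply, Pi.add_apply, smul_eq_mul, ← mul_sum, Complex.mul_im]
    rw [h1, h2]
    exact ⟨Submodule.sub_mem _ (Submodule.smul_mem _ _ hF.1) (Submodule.smul_mem _ _ hF.2),
      Submodule.add_mem _ (Submodule.smul_mem _ _ hF.2) (Submodule.smul_mem _ _ hF.1)⟩

/-- `pushRe (F_g) = |Stab M₀| · g`. [cite: FawziSaundersonParrilo2013, §5] -/
theorem pushRe_pull (g : PMSol n → ℝ) :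
    pushRe M₀ (pull M₀ g) = ((univ.filter fun σ : Equiv.Perm (Fin n) => σ • M₀ = M₀).card : ℝ) • g := by
  funext M
  rw [pushRe, push_pull, Pi.smul_apply, smul_eq_mul, ← Complex.ofReal_natCast, ← Complex.ofReal_mul,
    Complex.ofReal_re]

end MatchingInvariantSubspaces

open MatchingInvariantSubspaces in
/-- **Low-dimensional invariant subspaces are low-degree** (the cell's typed
`InvariantSubspaceLowDegree`, HOME/pnp-psdrank-p2/Sketch-v3.lean §4, verbatim): for even
`n ≥ 4k + 2`, every `𝔖ₙ`-invariant subspace of functions on the perfect matchings of `K_n` of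
dimension `< 2^k` is contained in `Pol_{≤k}`. The matching analogue of
[cite: FawziSaundersonParrilo2013, §5 (invariant subspaces for the parity polytope)], via
[cite: EllisFriedgutPilpel2011, Thm. 7] and [cite: GodsilMeagher2015, §15.5]. -/
theorem invariantSubspaceLowDegree :
    ∀ n k : ℕ, Even n → 4 * k + 2 ≤ n → ∀ V : Submodule ℝ (PMSol n → ℝ), IsPermInvariant V →
      Module.finrank ℝ V < 2 ^ k → V ≤ polLE n k := by
  intro n k hn hk V hV hdim g hg
  classical
  -- a base point
  obtain ⟨P₀, hP₀⟩ := exists_isPMOn_of_even n (univ : Finset (Fin n)) (by simp) hn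
  let M₀ : PMSol n := ⟨P₀, hP₀⟩
  -- the pull-back lies in `V_{2k}` = span of the `2k`-coset indicators
  have hW : pull M₀ g ∈ kCosetSpan n (2 * k) := by
    rw [← EllisFriedgutPilpel2011_thm7_holds n (2 * k) (by omega)]
    exact pullSpan_le_efpV M₀ hk hV hdim (pull_mem_pullSpan M₀ V hg)
  -- push forward
  have hpush := (pushRe_pushIm_mem_polLE M₀ hW).1
  rw [pushRe_pull] at hpush
  have hc : ((univ.filter fun σ : Equiv.Perm (Fin n) => σ • M₀ = M₀).card : ℝ) ≠ 0 :=
    Nat.cast_ne_zero.2 (card_stab_pos M₀).ne'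
  have := Submodule.smul_mem _ ((univ.filter fun σ : Equiv.Perm (Fin n) => σ • M₀ = M₀).card : ℝ)⁻¹ hpush
  rwa [smul_smul, inv_mul_cancel₀ hc, one_smul] at this

end Literature.Combinatorics.Optimization
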